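import Summits.Ventures.PercRepro.RankLevelSetMinorPairInduction

/-! # RankLevelSetMinorPairDiag — THE RESIDUE OF THE ELEMENT RECURSION IS THE DIAGONAL: THE CUMULATIVE SKEW ON
EVERY PAIR OF COMPLEMENTARY MINORS FOLLOWS FROM THE SINGLE REFLECTION INEQUALITY `p_i ≤ p_{m−1−i}` ON THE PAIRS WITH
`r₁ ≥ r₂` (night-1 g29; dossier §41.9)

`RankLevelSetMinorPairInduction` reduced the cumulative skew on the pairs with `r₁ < r₂` to the equal-rank slice (M₀)
(all the comparisons `i < j`, `i + j ≤ m − 1`). This file pushes the recursion through the pairs with `r₁ ≥ r₂` as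
well: there the natural parameter is `R = m − 1` for EVERY such pair, and the exact recursion at ANY `w ∈ E ∖ (Y₁ ∪ Y₂)`
delivers all the comparisons with `i + j ≤ m − 2` from the children (the through-`w` child has `r₁' ≥ r₂' − 1`, so its
parameter is `≥ m − 3`; the avoid-`w` child has `r₁'' ≥ r₂''`, so its parameter is `m − 2`); only the DIAGONAL
`i + j = m − 1` is left, the reflection inequality `p_i ≤ p_{m−1−i}` (`2i + 1 < m`).
* **(Diag)** = `MinorPairDiagSkew M` (a `Prop`, NOT asserted): `p_i(Y₁,Y₂) ≤ p_{m−1−i}(Y₁,Y₂)` for `2i + 1 < m`, for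
  every pair of disjoint independent `Y₁, Y₂ ⊆ E` with `r(E ∖ Y₁) + #Y₁ ≤ r(E ∖ Y₂) + #Y₂` (`r₁ ≥ r₂`). Its `(∅,∅)`
  case is `D_i ≤ D_{n−1−i} = D_{i+1}` — Mono, the Lorentzian consequence; for `r₁ ≥ r₂ + 1` it is WEAKER than the
  (false, for crossing pairs) «skewed right about `m/2`» of dossier §41.4 (d). Census (night-1 g29, own exact code):
  every matroid on ≤ 9 elements, all pairs with `#Y_i ≤ 2` (≤ 3 at `n ≤ 8`): 0 failures.
* **`minorPairSkew_all_of_diagSkew`** — THE JOINT INDUCTION on `m`: (Diag) for `M` gives `MinorPairSkew M Y₁ Y₂ (m − 1)`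
  on every pair with `r₁ ≥ r₂` and `MinorPairSkew M Y₁ Y₂ (m − 1 − d)` on every pair with `r₁ + d = r₂`.
* **`minorPairEqualRankSkew_of_diagSkew`**: (Diag) ⟹ (M₀); **`biContainSkew_of_diagSkew`**: (Diag) ⟹ (CX*);
  **`biIndepPerElem_of_diagSkew`**: (Diag) on every minor ⟹ (★★).
So the residue of the whole element induction, in the vocabulary of pairs, is ONE reflection inequality at ONE level per
pair, on the pairs whose first minor has the larger rank. Nothing here asserts (Diag); every declaration has a
docstring; imports: the cell's own modules and Mathlib only. Axioms: standard. -/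

namespace PercRepro

open Set Matroid

variable {α : Type} (M : Matroid α) [M.Finite]

omit [M.Finite] in
/-- **(Diag), the diagonal reflection inequality on the pairs with `r₁ ≥ r₂`** (a `Prop`, NOT asserted): for every
pair of disjoint independent `Y₁, Y₂ ⊆ E` with `r(E ∖ Y₁) + #Y₁ ≤ r(E ∖ Y₂) + #Y₂`, `p_i ≤ p_{m−1−i}` whenever
`2i + 1 < m = #(E ∖ (Y₁ ∪ Y₂))`. -/
def MinorPairDiagSkew : Prop :=
  ∀ Y₁ Y₂ : Set α, Y₁ ⊆ M.E → Y₂ ⊆ M.E → Disjoint Y₁ Y₂ → M.Indep Y₁ → M.Indep Y₂ →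
    mpRk M (M.E \ Y₁) + Y₁.ncard ≤ mpRk M (M.E \ Y₂) + Y₂.ncard →
    ∀ i : ℕ, 2 * i + 1 < (M.E \ (Y₁ ∪ Y₂)).ncard →
      minorPairCount M Y₁ Y₂ i ≤ minorPairCount M Y₁ Y₂ ((M.E \ (Y₁ ∪ Y₂)).ncard - 1 - i)

omit [M.Finite] in
/-- A cumulative skew with `R − 1` together with the diagonal `i + j = R` gives the cumulative skew with `R`. -/
lemma minorPairSkew_of_pred_of_diag {Y₁ Y₂ : Set α} {R : ℕ} (h : MinorPairSkew M Y₁ Y₂ (R - 1))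
    (hdiag : ∀ i, 2 * i < R → minorPairCount M Y₁ Y₂ i ≤ minorPairCount M Y₁ Y₂ (R - i)) :
    MinorPairSkew M Y₁ Y₂ R := by
  intro i j hij hR
  rcases Nat.lt_or_ge (i + j) R with hlt | hge
  · exact h i j hij (by omega)
  · have hj : j = R - i := by omega
    rw [hj]
    exact hdiag i (by omega)

/-- **THE JOINT INDUCTION** (dossier §41.9): from (Diag) for `M`, every pair of disjoint independent `Y₁, Y₂ ⊆ E`
with `m = #(E ∖ (Y₁ ∪ Y₂))` satisfies `MinorPairSkew M Y₁ Y₂ (m − 1)` when `r₁ ≥ r₂` and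
`MinorPairSkew M Y₁ Y₂ (m − 1 − d)` when `r₁ + d = r₂`. -/
theorem minorPairSkew_all_of_diagSkew (hdiag : MinorPairDiagSkew M) :
    ∀ (m : ℕ) (Y₁ Y₂ : Set α), Y₁ ⊆ M.E → Y₂ ⊆ M.E → Disjoint Y₁ Y₂ → M.Indep Y₁ → M.Indep Y₂ →
      (M.E \ (Y₁ ∪ Y₂)).ncard = m →
      (mpRk M (M.E \ Y₁) + Y₁.ncard ≤ mpRk M (M.E \ Y₂) + Y₂.ncard → MinorPairSkew M Y₁ Y₂ (m - 1)) ∧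
      (∀ d : ℕ, mpRk M (M.E \ Y₂) + Y₂.ncard + d = mpRk M (M.E \ Y₁) + Y₁.ncard →
        MinorPairSkew M Y₁ Y₂ (m - 1 - d)) := by
  intro m
  induction m using Nat.strong_induction_on with
  | _ m ih =>
  intro Y₁ Y₂ hY₁ hY₂ hdisj hI₁ hI₂ hm
  have hfin : (M.E \ (Y₁ ∪ Y₂)).Finite := M.ground_finite.subset Set.sdiff_subset
  have hY₁fin : Y₁.Finite := M.ground_finite.subset hY₁
  have hY₂fin : Y₂.Finite := M.ground_finite.subset hY₂
  -- the two children of a pair at an element `w`, with their rank bookkeeping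
  have hchildren : ∀ w ∈ M.E \ (Y₁ ∪ Y₂),
      (M.Indep (insert w Y₁) → MinorPairSkew M (insert w Y₁) Y₂ (m - 3) ∨
        (mpRk M (M.E \ Y₂) + Y₂.ncard < mpRk M (M.E \ insert w Y₁) + (insert w Y₁).ncard ∧
          MinorPairSkew M (insert w Y₁) Y₂ (m - 2 - (mpRk M (M.E \ insert w Y₁) + (insert w Y₁).ncard -
            (mpRk M (M.E \ Y₂) + Y₂.ncard))))) ∧
      (M.Indep (insert w Y₂) → mpRk M (M.E \ Y₁) + Y₁.ncard ≤ mpRk M (M.E \ insert w Y₂) + (insert w Y₂).ncard →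
        MinorPairSkew M Y₁ (insert w Y₂) (m - 2)) := by
    intro w hw
    have hwE : w ∈ M.E := hw.1
    have hwY₁ : w ∉ Y₁ := fun h => hw.2 (Or.inl h)
    have hwY₂ : w ∉ Y₂ := fun h => hw.2 (Or.inr h)
    have hm1 : ((M.E \ (Y₁ ∪ Y₂)) \ {w}).ncard = m - 1 := by
      rw [Set.ncard_sdiff_singleton_of_mem hw, hm]
    have hmpos : 1 ≤ m := by
      rw [← hm]; exact (Set.ncard_pos hfin).mpr ⟨w, hw⟩
    constructor
    · intro hI₁'
      have hdisj₁ : Disjoint (insert w Y₁) Y₂ := by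
        rw [Set.disjoint_left]
        intro x hx hx'
        rcases Set.mem_insert_iff.mp hx with rfl | hx
        · exact hwY₂ hx'
        · exact Set.disjoint_left.mp hdisj hx hx'
      have hih := ih (m - 1) (by omega) (insert w Y₁) Y₂ (Set.insert_subset hwE hY₁) hY₂ hdisj₁ hI₁' hI₂
        (by rw [ground_sdiff_insert_left, hm1])
      rcases Nat.lt_or_ge (mpRk M (M.E \ Y₂) + Y₂.ncard) (mpRk M (M.E \ insert w Y₁) + (insert w Y₁).ncard)
        with hlt | hge
      · right
        refine ⟨hlt, ?_⟩
        have h2 := hih.2 (mpRk M (M.E \ insert w Y₁) + (insert w Y₁).ncard - (mpRk M (M.E \ Y₂) + Y₂.ncard))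
          (by omega)
        exact minorPairSkew_mono M h2 (by omega)
      · left
        exact minorPairSkew_mono M (hih.1 hge) (by omega)
    · intro hI₂' hle
      have hdisj₂ : Disjoint Y₁ (insert w Y₂) := by
        rw [Set.disjoint_left]
        intro x hx hx'
        rcases Set.mem_insert_iff.mp hx' with rfl | hx'
        · exact hwY₁ hx
        · exact Set.disjoint_left.mp hdisj hx hx'
      have hih := ih (m - 1) (by omega) Y₁ (insert w Y₂) hY₁ (Set.insert_subset hwE hY₂) hdisj₂ hI₁ hI₂'
        (by rw [ground_sdiff_insert_right, hm1])
      exact minorPairSkew_mono M (hih.1 hle) (by omega)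
  -- the rank of the avoid-`w` child: `r(E ∖ (Y₂ + w)) + 1 ≥ r(E ∖ Y₂)`
  have hright : ∀ w ∈ M.E \ (Y₁ ∪ Y₂),
      mpRk M (M.E \ Y₂) + Y₂.ncard ≤ mpRk M (M.E \ insert w Y₂) + (insert w Y₂).ncard := by
    intro w hw
    have hwY₂ : w ∉ Y₂ := fun h => hw.2 (Or.inr h)
    have hE2 : M.E \ insert w Y₂ = (M.E \ Y₂) \ {w} := by
      ext x
      simp only [Set.mem_sdiff, Set.mem_insert_iff, Set.mem_singleton_iff, not_or]
      tauto
    have hins : mpRk M ((M.E \ Y₂) \ {w}) + 1 ≥ mpRk M (M.E \ Y₂) := by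
      have h := mpRk_insert_le M w ((M.E \ Y₂) \ {w})
      have hwX : w ∈ M.E \ Y₂ := ⟨hw.1, hwY₂⟩
      rw [Set.insert_sdiff_self_of_mem hwX] at h
      exact h
    rw [hE2, Set.ncard_insert_of_notMem hwY₂ hY₂fin]
    omega
  -- the rank of the through-`w` child: `r(E ∖ (Y₁ + w)) + 1 ≥ r(E ∖ Y₁)`, so its deficit is at most one more
  have hleft : ∀ w ∈ M.E \ (Y₁ ∪ Y₂),
      mpRk M (M.E \ insert w Y₁) + (insert w Y₁).ncard ≤ mpRk M (M.E \ Y₁) + Y₁.ncard + 1 := by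
    intro w hw
    have hwY₁ : w ∉ Y₁ := fun h => hw.2 (Or.inl h)
    have hE1 : M.E \ insert w Y₁ = (M.E \ Y₁) \ {w} := by
      ext x
      simp only [Set.mem_sdiff, Set.mem_insert_iff, Set.mem_singleton_iff, not_or]
      tauto
    have hmono : mpRk M ((M.E \ Y₁) \ {w}) ≤ mpRk M (M.E \ Y₁) := mpRk_mono M Set.sdiff_subset
    rw [hE1, Set.ncard_insert_of_notMem hwY₁ hY₁fin]
    omega
  -- PART 1: `r₁ ≥ r₂`, parameter `m − 1`
  have part1 : mpRk M (M.E \ Y₁) + Y₁.ncard ≤ mpRk M (M.E \ Y₂) + Y₂.ncard → MinorPairSkew M Y₁ Y₂ (m - 1) := by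
    intro hle
    -- the sub-diagonal comparisons `i + j ≤ m − 2` from the children, the diagonal from (Diag)
    have hsub : MinorPairSkew M Y₁ Y₂ (m - 2) := by
      rcases Nat.lt_or_ge m 3 with hm3 | hm3
      · intro i j hij hR; omega
      obtain ⟨w, hw⟩ : (M.E \ (Y₁ ∪ Y₂)).Nonempty := by
        rw [← Set.ncard_pos hfin, hm]; omega
      obtain ⟨hc1, hc2⟩ := hchildren w hw
      apply minorPairSkew_of_split M hw
      · by_cases hI₁' : M.Indep (insert w Y₁)
        · rcases hc1 hI₁' with h | ⟨hlt, h⟩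
          · exact minorPairSkew_mono M h (by omega)
          · have := hleft w hw
            exact minorPairSkew_mono M h (by omega)
        · exact minorPairSkew_of_forall_eq_zero M (minorPairCount_eq_zero_of_not_indep_left M hI₁') _
      · by_cases hI₂' : M.Indep (insert w Y₂)
        · exact hc2 hI₂' (hle.trans (hright w hw))
        · exact minorPairSkew_of_forall_eq_zero M (minorPairCount_eq_zero_of_not_indep_right M hI₂') _
    refine minorPairSkew_of_pred_of_diag M (R := m - 1) (by rw [show m - 1 - 1 = m - 2 by omega]; exact hsub) ?_
    intro i hi
    have h := hdiag Y₁ Y₂ hY₁ hY₂ hdisj hI₁ hI₂ hle i (by omega)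
    rw [hm] at h
    exact h
  refine ⟨part1, ?_⟩
  -- PART 2: `r₁ + d = r₂`, parameter `m − 1 − d`
  intro d hrk
  rcases Nat.eq_zero_or_pos d with rfl | hd
  · rw [Nat.sub_zero]
    exact part1 (by omega)
  -- a non-coloop `w` of `M ↾ (E ∖ Y₂)` outside `Y₁ ∪ Y₂`
  obtain ⟨w, hw, hwcl⟩ := exists_mem_closure_of_pos M hY₁ hY₂ hdisj hI₁ hd hrk
  have hwE : w ∈ M.E := hw.1
  have hwY₁ : w ∉ Y₁ := fun h => hw.2 (Or.inl h)
  have hwY₂ : w ∉ Y₂ := fun h => hw.2 (Or.inr h)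
  have hm1 : ((M.E \ (Y₁ ∪ Y₂)) \ {w}).ncard = m - 1 := by
    rw [Set.ncard_sdiff_singleton_of_mem hw, hm]
  have hmpos : 1 ≤ m := by
    rw [← hm]; exact (Set.ncard_pos hfin).mpr ⟨w, hw⟩
  obtain ⟨hc1, hc2⟩ := hchildren w hw
  apply minorPairSkew_of_split M hw
  · by_cases hI₁' : M.Indep (insert w Y₁)
    · rcases hc1 hI₁' with h | ⟨hlt, h⟩
      · exact minorPairSkew_mono M h (by omega)
      · have := hleft w hw
        exact minorPairSkew_mono M h (by omega)
    · exact minorPairSkew_of_forall_eq_zero M (minorPairCount_eq_zero_of_not_indep_left M hI₁') _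
  · by_cases hI₂' : M.Indep (insert w Y₂)
    · -- the avoid-`w` child has deficit `d − 1` (the choice of `w`)
      have hE2 : M.E \ insert w Y₂ = (M.E \ Y₂) \ {w} := by
        ext x
        simp only [Set.mem_sdiff, Set.mem_insert_iff, Set.mem_singleton_iff, not_or]
        tauto
      have hrk2 : mpRk M ((M.E \ Y₂) \ {w}) = mpRk M (M.E \ Y₂) :=
        mpRk_sdiff_singleton_of_mem_closure M Set.sdiff_subset hwcl
      have hcard : (insert w Y₂).ncard = Y₂.ncard + 1 := Set.ncard_insert_of_notMem hwY₂ hY₂fin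
      have hdisj₂ : Disjoint Y₁ (insert w Y₂) := by
        rw [Set.disjoint_left]
        intro x hx hx'
        rcases Set.mem_insert_iff.mp hx' with rfl | hx'
        · exact hwY₁ hx
        · exact Set.disjoint_left.mp hdisj hx hx'
      have hih := ih (m - 1) (by omega) Y₁ (insert w Y₂) hY₁ (Set.insert_subset hwE hY₂) hdisj₂ hI₁ hI₂'
        (by rw [ground_sdiff_insert_right, hm1])
      have h2 := hih.2 (d - 1) (by rw [hE2, hrk2, hcard]; omega)
      exact minorPairSkew_mono M h2 (by omega)
    · exact minorPairSkew_of_forall_eq_zero M (minorPairCount_eq_zero_of_not_indep_right M hI₂') _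

/-- **(Diag) ⟹ (M₀)**: the diagonal reflection inequality on the pairs with `r₁ ≥ r₂` gives the full cumulative skew
on the equal-rank pairs. -/
theorem minorPairEqualRankSkew_of_diagSkew (hdiag : MinorPairDiagSkew M) : MinorPairEqualRankSkew M := by
  intro Y₁ Y₂ hY₁ hY₂ hdisj hI₁ hI₂ heq
  exact (minorPairSkew_all_of_diagSkew M hdiag _ Y₁ Y₂ hY₁ hY₂ hdisj hI₁ hI₂ rfl).1 heq.ge

/-- **(CX*) FROM (Diag)**: `MinorPairDiagSkew M → BiContainSkew M`. -/
theorem biContainSkew_of_diagSkew (hdiag : MinorPairDiagSkew M) : BiContainSkew M :=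
  biContainSkew_of_equalRankSkew M (minorPairEqualRankSkew_of_diagSkew M hdiag)

/-- **(★★) FROM (Diag) ON THE MINORS**: `(∀ N ≤m M, MinorPairDiagSkew N) → BiIndepPerElem M`. -/
theorem biIndepPerElem_of_diagSkew (h : ∀ N : Matroid α, N ≤m M → MinorPairDiagSkew N) : BiIndepPerElem M :=
  biIndepPerElem_of_equalRankSkew M (fun N hN =>
    haveI : N.Finite := ⟨M.ground_finite.subset hN.subset⟩
    minorPairEqualRankSkew_of_diagSkew N (h N hN))

end PercRepro
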